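import Summits.QuantumFields.YangMills.Theorems.UnitScaleTiltProp7TransplantDipolePotential
import Summits.QuantumFields.YangMills.Theorems.UnitScaleTiltProp7PinnedKernelBumps
import HarnessLib

/-!
# Route `UnitScaleTilt`, crux K1 «MinimiserStabilityRegPr» (stmt-QuantumFields-19200), route-R E′ path (α′), (E1-b) at the CURVED background, (A-cov) near datum, FILE «BUMP ROWS»:
# CARDINAL BUMPS AT THE `k`-CENTRES WITH ALL THREE ROWS (value `≤ 1`, step `≤ B₁ ≍ ℓ⁻¹`, Laplacian `≤ B₂ ≍ ℓ⁻²`, both branches `ℓ ≥ 10√d+6` ∕ `3 ≤ ℓ < 10√d+6` in one package) AND THE BUMP INTERPOLANT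
# `ψ̃ := Σ_y a_y·β_y` OF A DATUM SUPPORTED ON THE CENTRES OF A BALL — `ψ̃(e_y) = a_y`, `|ψ̃| ≤ D₀`, `|∂^±ψ̃| ≤ D₀B₁`, `|Δψ̃| ≤ D₀B₂`, `ψ̃` and its neighbours vanish off `{tdist(·,b) ≤ R + r_S + 1}`

Cell `ym3-torus`, width seat `ym3-torus-px22` (gen 3).  WHY A SIBLING of ✓p664882 `exists_bump_family`∕`exists_delta_family` and ✓p664410 `Prop7PinnedKernelBumps`: the flat (Lλ) near datum only needed the
LAPLACIAN row of the bumps; the framed transplant's near datum `u⁰ = ψ̃•R(Fr)Y` feeds ✓p675919's engine, whose junk terms read the VALUE and STEP rows as well.  THEOREMS ONLY (0 `def`, 0 `sorry`);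
`--supports stmt-QuantumFields-19200`, count-neutral.  YM₃ on T³ is a ladder rung (R3), not the Clay problem; nothing here claims the stub, the crux, d = 4 or the gap.

WHAT IS PROVED (ns `…Theorems.Prop7TransplantBumpRows`; `Site P 0`, centres `e_y = embIter k y`, `ℓ = L^k ≥ 3`, `c_d := 10√d + 6`).
* §1 ★★ `exists_bump_rows` — `∃ β B₁ B₂ r_S`: `0 ≤ B₁ ≤ 3c_d∕(2ℓ)`, `0 ≤ B₂ ≤ 9d·c_d²∕ℓ²`, `2r_S + 3 ≤ L^k`, `β_y(e_y) = 1`, `0 ≤ β ≤ 1`, `β_y z = 0` for `tdist(z,e_y) > r_S`, `|β_y(z±e_μ) − β_y z| ≤ B₁`, `|Δ₁β_y z| ≤ B₂`.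
* §2 ★ `abs_sum_mul_le_of_disjoint` (the «at most one active bump» bound of ✓p664410 for an arbitrary family `f_y` vanishing off pairwise disjoint `S_y`).
* §3 ★★★ `bumpInterp_rows` — for `a : Site P k → ℝ` with `|a| ≤ D₀` and `a_y = 0` unless `tdist(e_y, b) < R`: the five facts of the title for `ψ̃ z := Σ_y a_y·β_y z`, with `S_y := {tdist(·,e_y) ≤ r_S + 1}`.
HONEST SCOPE.  Flat lattice bookkeeping; the covariant numbers `N₃⁰ N₄⁰` are the next file.

References: T. Bałaban, CMP 99 (1985) 75–102 [Balaban1985RegularSpaces] ((1.14) p.78, (1.36) p.82); CMP 96 (1984) 223–250 [Balaban1984PropagatorsII] ((1.9) p.226).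
-/

set_option autoImplicit false

noncomputable section

open scoped BigOperators
open Finset

namespace Summit.QuantumFields.YangMills.Theorems.Prop7TransplantBumpRows

open Literature.MathematicalPhysics.QuantumFieldTheory.Balaban1983to89
open LatticeFieldCalculus
open B15DeterminingSets (embIter)
open B3Taylor310LocalRemainder (tdist_comm tdist_self tdist_triangle)
open Prop7TorusAgmonWeight (exists_scale_cutoff)
open Prop7PinnedKernelGeometry (tdist_shift_le_add_one tdist_le_tdist_shift_add_one tdist_unshift_le_add_one tdist_le_tdist_unshift_add_one pow_le_tdist_embIter_of_ne)
open Prop7PinnedKernelBumps (laplace_sum_mul_const bump_ext_apply_centre)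

variable {P : Params}

/-! ## §1 ★★ The bump package with value, step and Laplacian rows -/

/-- ★★ **CARDINAL BUMPS AT THE CENTRES, ALL ROWS, BOTH BRANCHES** (`ℓ = L^k ≥ 3`, `c_d = 10√d + 6`): smooth scale cutoffs of scale `ℓ∕c_d` when `ℓ ≥ c_d` (✓ `exists_scale_cutoff`), indicators of the centres
otherwise; in both cases `β_y(e_y) = 1`, `0 ≤ β ≤ 1`, `β_y = 0` beyond `tdist = r_S` with `2r_S + 3 ≤ L^k`, steps `≤ B₁ ≤ 3c_d∕(2ℓ)`, `|Δ₁β_y| ≤ B₂ ≤ 9d·c_d²∕ℓ²`. [cite: Balaban1985RegularSpaces, (1.14) p.78] -/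
theorem exists_bump_rows [DecidableEq (Site P 0)] {k : ℕ} (_hk : k ≤ P.m + P.K) (h3 : 3 ≤ P.L ^ k) :
    ∃ (β : Site P k → Site P 0 → ℝ) (B₁ B₂ : ℝ) (rS : ℕ),
      0 ≤ B₁ ∧ B₁ ≤ 3 * (10 * Real.sqrt P.d + 6) / (2 * ((P.L : ℝ) ^ k)) ∧
      0 ≤ B₂ ∧ B₂ ≤ 9 * P.d * (10 * Real.sqrt P.d + 6) ^ 2 / ((P.L : ℝ) ^ k) ^ 2 ∧
      2 * rS + 3 ≤ P.L ^ k ∧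
      (∀ y, β y (embIter k y) = 1) ∧
      (∀ y z, 0 ≤ β y z ∧ β y z ≤ 1) ∧
      (∀ y z, rS < Site.tdist z (embIter k y) → β y z = 0) ∧
      (∀ y z μ, |β y (z.shift μ) - β y z| ≤ B₁ ∧ |β y (z.unshift μ) - β y z| ≤ B₁) ∧
      (∀ y z, |laplace 1 (β y) z| ≤ B₂) := by
  have hsd : 0 ≤ Real.sqrt P.d := Real.sqrt_nonneg _
  have hd0 : (0 : ℝ) ≤ P.d := Nat.cast_nonneg _
  set ℓ : ℝ := (P.L : ℝ) ^ k with hℓ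
  have hℓ3 : (3 : ℝ) ≤ ℓ := by rw [hℓ]; exact_mod_cast h3
  have hℓ0 : 0 < ℓ := by linarith
  set cd : ℝ := 10 * Real.sqrt P.d + 6 with hcd
  have hcd6 : 6 ≤ cd := by rw [hcd]; linarith
  have hcd0 : 0 < cd := by linarith
  by_cases hbig : cd ≤ ℓ
  · -- smooth branch: scale cutoffs of scale `ℓβ = ℓ/c_d ≥ 1`
    set ℓβ : ℝ := ℓ / cd with hℓβ
    have hℓβ1 : 1 ≤ ℓβ := by rw [hℓβ, le_div_iff₀ hcd0]; linarith
    have hℓβ0 : 0 < ℓβ := by linarith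
    have hcut := fun y : Site P k => exists_scale_cutoff (P := P) (j := 0) (embIter k y) hℓβ1
    choose β h01 hin hout hd1 hd2 hmix hlap using hcut
    set rS : ℕ := ⌊5 * Real.sqrt P.d * ℓβ⌋₊ with hrS
    have hrSle : (rS : ℝ) ≤ 5 * Real.sqrt P.d * ℓβ := Nat.floor_le (by positivity)
    have hrSlt : 5 * Real.sqrt P.d * ℓβ < (rS : ℝ) + 1 := Nat.lt_floor_add_one _
    refine ⟨β, 3 / (2 * ℓβ), 9 * P.d * 1 ^ 2 / ℓβ ^ 2, rS, by positivity, ?_, by positivity, ?_, ?_, ?_, ?_, ?_, ?_, ?_⟩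
    · rw [hℓβ]; field_simp; rfl
    · rw [hℓβ, one_pow, mul_one]; field_simp; rfl
    · -- `2 r_S + 3 ≤ L^k`: `2·5√d·ℓ/c_d + 3 ≤ ℓ` since `ℓ·(c_d − 10√d) = 6ℓ ≥ 3c_d`
      have h1 : 2 * (rS : ℝ) + 3 ≤ ℓ := by
        have e : 5 * Real.sqrt P.d * ℓβ * cd = 5 * Real.sqrt P.d * ℓ := by rw [hℓβ]; field_simp
        nlinarith [mul_le_mul_of_nonneg_right hrSle hcd0.le]
      rw [hℓ] at h1
      exact_mod_cast h1
    · intro y; exact hin y _ (by rw [tdist_self]; push_cast; linarith)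
    · intro y z; exact h01 y z
    · intro y z hz
      refine hout y z ?_
      have : (rS : ℝ) + 1 ≤ (Site.tdist z (embIter k y) : ℝ) := by exact_mod_cast hz
      linarith
    · intro y z μ; exact hd1 y z μ
    · intro y z
      have := hlap y 1 z
      simpa only [one_pow, mul_one] using this
  · -- delta branch: indicators of the centres (`3 ≤ ℓ < c_d`)
    rw [not_le] at hbig
    refine ⟨fun y z => if z = embIter k y then 1 else 0, 1, 2 * P.d, 0, zero_le_one, ?_, by positivity, ?_, by omega, ?_, ?_, ?_, ?_, ?_⟩
    · rw [le_div_iff₀ (by positivity)]; nlinarith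
    · rw [le_div_iff₀ (by positivity)]
      have : ℓ ^ 2 ≤ cd ^ 2 := pow_le_pow_left₀ hℓ0.le hbig.le 2
      nlinarith
    · intro y; simp
    · intro y z; by_cases h : z = embIter k y <;> simp [h]
    · intro y z hz
      have hne : z ≠ embIter k y := by
        intro h; rw [h, tdist_self] at hz; exact Nat.lt_irrefl 0 hz
      simp [hne]
    · have key : ∀ (p q : Prop) [Decidable p] [Decidable q], |(if p then (1:ℝ) else 0) - (if q then (1:ℝ) else 0)| ≤ 1 := by
        intro p q _ _; split_ifs <;> norm_num
      intro y z μ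
      exact ⟨key _ _, key _ _⟩
    · have key : ∀ (p q r : Prop) [Decidable p] [Decidable q] [Decidable r],
          |((if p then (1:ℝ) else 0) + (if p then (1:ℝ) else 0) - (if q then (1:ℝ) else 0) - (if r then (1:ℝ) else 0))| ≤ 2 := by
        intro p q r _ _ _; split_ifs <;> norm_num
      intro y z
      simp only [laplace, one_pow, one_smul]
      calc |∑ μ : Fin P.d, ((if z = embIter k y then (1:ℝ) else 0) + (if z = embIter k y then (1:ℝ) else 0)
            - (if z.shift μ = embIter k y then (1:ℝ) else 0) - (if z.unshift μ = embIter k y then (1:ℝ) else 0))|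
          ≤ ∑ μ : Fin P.d, |((if z = embIter k y then (1:ℝ) else 0) + (if z = embIter k y then (1:ℝ) else 0)
            - (if z.shift μ = embIter k y then (1:ℝ) else 0) - (if z.unshift μ = embIter k y then (1:ℝ) else 0))| := Finset.abs_sum_le_sum_abs _ _
        _ ≤ ∑ _μ : Fin P.d, (2 : ℝ) := Finset.sum_le_sum fun μ _ => key _ _ _
        _ = 2 * P.d := by rw [Finset.sum_const, Finset.card_univ, Fintype.card_fin, nsmul_eq_mul]; ring

/-! ## §2 ★ At most one active bump -/

/-- ★ **AT MOST ONE ACTIVE TERM**: if `a_y = 0` off `Y₀`, `|a_y| ≤ D₀`, `f_y = 0` off `S_y`, `|f_y| ≤ B`, and the `S_y` (`y ∈ Y₀`) are pairwise disjoint, then `|Σ_y a_y·f_y z| ≤ D₀·B` at every `z`, and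
the sum vanishes unless `z ∈ S_y` for some `y ∈ Y₀` (✓p664410 `abs_laplace_bump_ext_le` with `Δβ_y ↦ f_y`). [cite: Balaban1985RegularSpaces, (1.14) p.78] -/
theorem abs_sum_mul_le_of_disjoint {Y : Type*} [Fintype Y] (a : Y → ℝ) (f : Y → Site P 0 → ℝ) (S : Y → Finset (Site P 0)) (Y₀ : Finset Y) {D₀ B : ℝ}
    (hD₀ : 0 ≤ D₀) (hB : 0 ≤ B) (ha0 : ∀ y ∉ Y₀, a y = 0) (haD : ∀ y, |a y| ≤ D₀)
    (hfS : ∀ y z, z ∉ S y → f y z = 0) (hfB : ∀ y z, |f y z| ≤ B)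
    (hdisj : ∀ y ∈ Y₀, ∀ y' ∈ Y₀, y ≠ y' → Disjoint (S y) (S y')) (z : Site P 0) :
    |∑ y, a y * f y z| ≤ D₀ * B ∧ ((∀ y ∈ Y₀, z ∉ S y) → ∑ y, a y * f y z = 0) := by
  classical
  have hvan : ∀ y, y ∉ Y₀.filter (fun y => z ∈ S y) → a y * f y z = 0 := by
    intro y hy
    rw [Finset.mem_filter, not_and] at hy
    by_cases hy0 : y ∈ Y₀
    · rw [hfS y z (hy hy0), mul_zero]
    · rw [ha0 y hy0, zero_mul]
  have hrestrict : ∑ y, a y * f y z = ∑ y ∈ Y₀.filter (fun y => z ∈ S y), a y * f y z := by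
    rw [← Finset.sum_subset (Finset.subset_univ _)]
    intro y _ hy
    exact hvan y hy
  have hcard : (Y₀.filter (fun y => z ∈ S y)).card ≤ 1 := by
    rw [Finset.card_le_one]
    intro y hy y' hy'
    rw [Finset.mem_filter] at hy hy'
    by_contra h
    exact Finset.disjoint_left.mp (hdisj y hy.1 y' hy'.1 h) hy.2 hy'.2
  refine ⟨?_, fun hz => ?_⟩
  · rw [hrestrict]
    calc |∑ y ∈ Y₀.filter (fun y => z ∈ S y), a y * f y z|
        ≤ ∑ y ∈ Y₀.filter (fun y => z ∈ S y), |a y * f y z| := Finset.abs_sum_le_sum_abs _ _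
      _ ≤ ∑ _y ∈ Y₀.filter (fun y => z ∈ S y), D₀ * B := Finset.sum_le_sum fun y _ => by
          rw [abs_mul]; exact mul_le_mul (haD y) (hfB y z) (abs_nonneg _) hD₀
      _ = (Y₀.filter (fun y => z ∈ S y)).card * (D₀ * B) := by rw [Finset.sum_const, nsmul_eq_mul]
      _ ≤ 1 * (D₀ * B) := mul_le_mul_of_nonneg_right (by exact_mod_cast hcard) (by positivity)
      _ = D₀ * B := one_mul _
  · rw [hrestrict]
    have hempty : Y₀.filter (fun y => z ∈ S y) = ∅ := by
      rw [Finset.filter_eq_empty_iff]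
      intro y hy
      exact hz y hy
    rw [hempty, Finset.sum_empty]

/-! ## §3 ★★★ The bump interpolant of a datum living on the centres of a ball -/

/-- ★★★ **THE BUMP INTERPOLANT** `ψ̃ z := Σ_y a_y·β_y z` (bumps of §1; `|a| ≤ D₀`, `a_y = 0` unless `tdist(e_y, b) < R`): `ψ̃(e_y) = a_y`; `|ψ̃| ≤ D₀`; `|ψ̃(z ± e_μ) − ψ̃ z| ≤ D₀·B₁`; `|Δ₁ψ̃ z| ≤ D₀·B₂`;
and `ψ̃ z = ψ̃(z ± e_μ) = 0` whenever `tdist(z, b) ≥ R + r_S + 2` (at most one bump is active at any site: the balls `{tdist(·,e_y) ≤ r_S + 1}` are pairwise disjoint since `2r_S + 3 ≤ L^k ≤ tdist(e_y, e_{y′})`).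
[cite: Balaban1985RegularSpaces, (1.14) p.78, (1.36) p.82] -/
theorem bumpInterp_rows [DecidableEq (Site P 0)] {k : ℕ} (hk : k ≤ P.m + P.K)
    (β : Site P k → Site P 0 → ℝ) {B₁ B₂ : ℝ} {rS : ℕ} (hsep : 2 * rS + 3 ≤ P.L ^ k)
    (hβ1 : ∀ y, β y (embIter k y) = 1) (hβ01 : ∀ y z, 0 ≤ β y z ∧ β y z ≤ 1) (hβ0 : ∀ y z, rS < Site.tdist z (embIter k y) → β y z = 0)
    (hβd : ∀ y z μ, |β y (z.shift μ) - β y z| ≤ B₁ ∧ |β y (z.unshift μ) - β y z| ≤ B₁) (hβL : ∀ y z, |laplace 1 (β y) z| ≤ B₂)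
    (a : Site P k → ℝ) (b : Site P 0) {R : ℕ} {D₀ : ℝ} (hD₀ : 0 ≤ D₀) (haD : ∀ y, |a y| ≤ D₀) (ha0 : ∀ y, R ≤ Site.tdist (embIter k y) b → a y = 0) :
    (∀ y, ∑ y', a y' * β y' (embIter k y) = a y) ∧
    (∀ z, |∑ y, a y * β y z| ≤ D₀) ∧
    (∀ z μ, |∑ y, a y * β y (z.shift μ) - ∑ y, a y * β y z| ≤ D₀ * B₁ ∧ |∑ y, a y * β y (z.unshift μ) - ∑ y, a y * β y z| ≤ D₀ * B₁) ∧
    (∀ z, |laplace 1 (fun x => ∑ y, a y * β y x) z| ≤ D₀ * B₂) ∧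
    (∀ z, R + rS + 2 ≤ Site.tdist z b → (∑ y, a y * β y z) = 0 ∧ (∀ μ, (∑ y, a y * β y (z.shift μ)) = 0) ∧ ∀ μ, (∑ y, a y * β y (z.unshift μ)) = 0) := by
  classical
  -- the active centres and their balls
  set Y₀ : Finset (Site P k) := univ.filter fun y => Site.tdist (embIter k y) b < R with hY₀
  set S : Site P k → Finset (Site P 0) := fun y => univ.filter fun z => Site.tdist z (embIter k y) ≤ rS + 1 with hS
  have ha0' : ∀ y ∉ Y₀, a y = 0 := fun y hy => ha0 y (by rw [hY₀, Finset.mem_filter, not_and] at hy; exact not_lt.1 (hy (Finset.mem_univ y)))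
  have hmemS : ∀ y z, z ∈ S y ↔ Site.tdist z (embIter k y) ≤ rS + 1 := fun y z => by rw [hS]; simp only [Finset.mem_filter, Finset.mem_univ, true_and]
  have hdisj : ∀ y ∈ Y₀, ∀ y' ∈ Y₀, y ≠ y' → Disjoint (S y) (S y') := by
    intro y _ y' _ hyy'
    rw [Finset.disjoint_left]
    intro z hz hz'
    rw [hmemS] at hz hz'
    have hfar := pow_le_tdist_embIter_of_ne hk hyy'
    have htri := tdist_triangle (embIter k y) z (embIter k y')
    rw [tdist_comm (embIter k y) z] at htri
    omega
  -- the three families vanish off `S y`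
  have hval0 : ∀ y z, z ∉ S y → β y z = 0 := fun y z hz => hβ0 y z (by rw [hmemS] at hz; omega)
  have hsh0 : ∀ μ y z, z ∉ S y → β y (z.shift μ) - β y z = 0 := by
    intro μ y z hz
    rw [hmemS] at hz
    have := tdist_le_tdist_shift_add_one z (embIter k y) μ
    rw [hβ0 y z (by omega), hβ0 y (z.shift μ) (by omega), sub_zero]
  have hush0 : ∀ μ y z, z ∉ S y → β y (z.unshift μ) - β y z = 0 := by
    intro μ y z hz
    rw [hmemS] at hz
    have := tdist_le_tdist_unshift_add_one z (embIter k y) μ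
    rw [hβ0 y z (by omega), hβ0 y (z.unshift μ) (by omega), sub_zero]
  have hlap0 : ∀ y z, z ∉ S y → laplace 1 (β y) z = 0 := by
    intro y z hz
    rw [hmemS] at hz
    simp only [laplace, one_pow, one_smul]
    refine Finset.sum_eq_zero fun μ _ => ?_
    have h1 := tdist_le_tdist_shift_add_one z (embIter k y) μ
    have h2 := tdist_le_tdist_unshift_add_one z (embIter k y) μ
    rw [hβ0 y z (by omega), hβ0 y (z.shift μ) (by omega), hβ0 y (z.unshift μ) (by omega)]; ring
  have hβabs : ∀ y z, |β y z| ≤ 1 := fun y z => abs_le.2 ⟨by linarith [(hβ01 y z).1], (hβ01 y z).2⟩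
  obtain ⟨y₀⟩ : Nonempty (Site P k) := ⟨default⟩
  obtain ⟨μ₀⟩ : Nonempty (Fin P.d) := inferInstance
  have hB₁0 : 0 ≤ B₁ := (abs_nonneg _).trans (hβd y₀ b μ₀).1
  have hB₂0 : 0 ≤ B₂ := (abs_nonneg _).trans (hβL y₀ b)
  refine ⟨fun y => ?_, fun z => ?_, fun z μ => ⟨?_, ?_⟩, fun z => ?_, fun z hz => ?_⟩
  · -- value at a centre
    refine bump_ext_apply_centre a β (embIter k) hβ1 (fun y y' hyy' => hβ0 y _ ?_) y
    have := pow_le_tdist_embIter_of_ne hk hyy'.symm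
    omega
  · have h := (abs_sum_mul_le_of_disjoint a β S Y₀ hD₀ zero_le_one ha0' haD hval0 hβabs hdisj z).1
    simpa only [mul_one] using h
  · rw [← Finset.sum_sub_distrib]
    have e : ∑ y, (a y * β y (z.shift μ) - a y * β y z) = ∑ y, a y * (β y (z.shift μ) - β y z) := Finset.sum_congr rfl fun y _ => by ring
    rw [e]
    exact (abs_sum_mul_le_of_disjoint a (fun y z => β y (z.shift μ) - β y z) S Y₀ hD₀ hB₁0 ha0' haD (hsh0 μ) (fun y z => (hβd y z μ).1) hdisj z).1
  · rw [← Finset.sum_sub_distrib]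
    have e : ∑ y, (a y * β y (z.unshift μ) - a y * β y z) = ∑ y, a y * (β y (z.unshift μ) - β y z) := Finset.sum_congr rfl fun y _ => by ring
    rw [e]
    exact (abs_sum_mul_le_of_disjoint a (fun y z => β y (z.unshift μ) - β y z) S Y₀ hD₀ hB₁0 ha0' haD (hush0 μ) (fun y z => (hβd y z μ).2) hdisj z).1
  · rw [laplace_sum_mul_const]
    exact (abs_sum_mul_le_of_disjoint a (fun y z => laplace 1 (β y) z) S Y₀ hD₀ hB₂0 ha0' haD hlap0 hβL hdisj z).1
  · -- far from `b`: no active ball contains `z` or its neighbours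
    have hfar : ∀ w : Site P 0, R + rS + 1 ≤ Site.tdist w b → ∀ y ∈ Y₀, w ∉ S y := by
      intro w hw y hy hwS
      rw [hY₀, Finset.mem_filter] at hy
      rw [hmemS] at hwS
      have htri := tdist_triangle w (embIter k y) b
      omega
    refine ⟨(abs_sum_mul_le_of_disjoint a β S Y₀ hD₀ zero_le_one ha0' haD hval0 hβabs hdisj z).2 (hfar z (by omega)), fun μ => ?_, fun μ => ?_⟩
    · have := tdist_le_tdist_shift_add_one z b μ
      exact (abs_sum_mul_le_of_disjoint a β S Y₀ hD₀ zero_le_one ha0' haD hval0 hβabs hdisj (z.shift μ)).2 (hfar _ (by omega))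
    · have := tdist_le_tdist_unshift_add_one z b μ
      exact (abs_sum_mul_le_of_disjoint a β S Y₀ hD₀ zero_le_one ha0' haD hval0 hβabs hdisj (z.unshift μ)).2 (hfar _ (by omega))

end Summit.QuantumFields.YangMills.Theorems.Prop7TransplantBumpRows

end
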